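import Summits.AnomalousDissipation.AnomalousDissipation.Theorems.SawtoothPulseCascadeK1LocalisedCascadeCutoffSup

/-!
# K1loc, line `Spectral` / thin start — helper: ABEL SUMMATION AND THE CLOSED FORM OF THE EXACT CHIRP'S COEFFICIENTS (S-D, «Osc» 1/3)

Helper file of the prover lane on the crux `K1LocalisedCascade` (stmt-AnomalousDissipation-19491), route
`SawtoothPulseCascade` (S-D fibre ledger; constants of the twist cut-off half-step, memo v14 §3(c)).  First of three files
replacing the ABSOLUTE kernel-tail bound of the mid-band cut-off of the exact chirp (`…SawtoothChirp.norm_circleCutoff_exactChirp_le`,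
`|ψ⋆g₀| ≤ 2∫_{‖s‖≥d/2}|k_ψ| ≤ 2/(D·d)`) by an OSCILLATORY one (`…ChirpCutoffOsc`: `≤ 1/(2πD·d) + 2N/(πD)`):
* §1 `norm_geom_sum_exp_le`, **`norm_sum_Icc_antitone_mul_exp_le`** (Abel summation): for `a ≥ 0` non-increasing on `[A, B]`,
  `‖Σ_{q=A}^{B} a(q)e^{2πiqx}‖ ≤ a(A)/|sin πx|`;
* §2 `exists_exactChirp_real` and **`fourierCoeff_exactChirp_eq`**: the one-tooth chirp `h(t) = exp(−2πiμ·tri(2πt)/(2π))` with REAL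
  strain `μ` (needed for the `N`-tooth rescaling `ĝ₀(Nq) = ĥ(q)`, `μ = λ/N`) has the CLOSED-FORM coefficients
  `ĥ(q) = sin(π(μ+q)/2)/(π(μ+q)) + e^{−iπq}·sin(π(μ−q)/2)/(π(μ−q))` (`μ ± q ≠ 0`; the landed `…ExactChirp` has the bound only).
No definitions; nothing about the crux. [cite: Grafakos2014, Prop. 3.1.2 (5), §3.1.3] [problem: turb]
-/

-- `Summit.<Summit>.<Problem>`: single-conjunct summit, the duplicate namespace segment is deliberate.
set_option linter.dupNamespace false

noncomputable section

namespace Summit.AnomalousDissipation.AnomalousDissipation.Theorems.SawtoothPulseCascade.K1Window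

open MeasureTheory Set Filter Topology Function Complex AddCircle intervalIntegral
open scoped Real
open Literature.Analysis Literature.Analysis.FunctionSpaces Literature.Analysis.FunctionSpaces.Torus Literature.Analysis.FluidPDE
open Literature.Analysis.FluidPDE.SawtoothCascade
open Summit.AnomalousDissipation.AnomalousDissipation.Theorems.SawtoothPulseCascade.K1Start

/-! ## §1 Abel summation against a geometric sum -/

/-- `‖exp(2πix) − 1‖ = 2|sin(πx)|`. [folklore] -/
theorem norm_exp_two_pi_mul_I_sub_one (x : ℝ) :
    ‖Complex.exp (2 * π * I * x) - 1‖ = 2 * |Real.sin (π * x)| := by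
  rw [show (2 * π * I * x : ℂ) = I * ((2 * π * x : ℝ) : ℂ) by push_cast; ring, Complex.norm_exp_I_mul_ofReal_sub_one,
    show (2 * π * x : ℝ) / 2 = π * x by ring, norm_mul, Real.norm_eq_abs, Real.norm_eq_abs, abs_two]

/-- **Geometric sums of characters**: `‖Σ_{j<k} exp(2πi(a+j)x)‖ ≤ 1/|sin(πx)|` when `sin(πx) ≠ 0`. [cite: Grafakos2014, §3.1.3] -/
theorem norm_geom_sum_exp_le (a : ℤ) (k : ℕ) {x : ℝ} (hx : Real.sin (π * x) ≠ 0) :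
    ‖∑ j ∈ Finset.range k, Complex.exp (2 * π * I * ((a + j : ℤ) : ℂ) * x)‖ ≤ 1 / |Real.sin (π * x)| := by
  set z : ℂ := Complex.exp (2 * π * I * x) with hz
  have hz1 : z ≠ 1 := by
    intro h
    have h2 := norm_exp_two_pi_mul_I_sub_one x
    rw [← hz, h, sub_self, norm_zero] at h2
    exact hx (by linarith [abs_nonneg (Real.sin (π * x)), abs_eq_zero.mp (by linarith : |Real.sin (π * x)| = 0)])
  have hterm : ∀ j : ℕ, Complex.exp (2 * π * I * ((a + j : ℤ) : ℂ) * x) = Complex.exp (2 * π * I * a * x) * z ^ j := by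
    intro j
    rw [hz, ← Complex.exp_nat_mul, ← Complex.exp_add]
    congr 1; push_cast; ring
  simp_rw [hterm]
  rw [← Finset.mul_sum, geom_sum_eq hz1, norm_mul]
  have hn1 : ‖Complex.exp (2 * π * I * a * x)‖ = 1 := by
    rw [show (2 * π * I * a * x : ℂ) = ((2 * π * a * x : ℝ) : ℂ) * I by push_cast; ring, Complex.norm_exp_ofReal_mul_I]
  rw [hn1, one_mul, norm_div]
  have hnum : ‖z ^ k - 1‖ ≤ 2 := by
    refine (norm_sub_le _ _).trans ?_
    rw [norm_pow, hz, show (2 * π * I * x : ℂ) = ((2 * π * x : ℝ) : ℂ) * I by push_cast; ring,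
      Complex.norm_exp_ofReal_mul_I, one_pow, norm_one]; norm_num
  have hden : ‖z - 1‖ = 2 * |Real.sin (π * x)| := norm_exp_two_pi_mul_I_sub_one x
  rw [hden]
  have hpos : 0 < |Real.sin (π * x)| := abs_pos.mpr hx
  rw [div_le_div_iff₀ (by positivity) hpos]
  nlinarith

/-- **Abel summation**: for `a : ℤ → ℝ` non-increasing and non-negative on `[A, B]`,
`‖Σ_{q∈[A,B]} a(q)·exp(2πiqx)‖ ≤ a(A)/|sin(πx)|` when `sin(πx) ≠ 0`. [cite: Grafakos2014, §3.1.3] -/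
theorem norm_sum_Icc_antitone_mul_exp_le {a : ℤ → ℝ} {A B : ℤ} (hAB : A ≤ B)
    (hanti : ∀ q, A ≤ q → q < B → a (q + 1) ≤ a q) (hB0 : 0 ≤ a B) {x : ℝ} (hx : Real.sin (π * x) ≠ 0) :
    ‖∑ q ∈ Finset.Icc A B, (a q : ℂ) * Complex.exp (2 * π * I * q * x)‖ ≤ a A / |Real.sin (π * x)| := by
  -- reindex `q = A + i`, `i < L`
  set L : ℕ := (B - A).toNat + 1 with hL
  have hBA : ((B - A).toNat : ℤ) = B - A := Int.toNat_of_nonneg (by omega)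
  set f : ℕ → ℂ := fun i => (a (A + i) : ℂ) with hf
  set g : ℕ → ℂ := fun i => Complex.exp (2 * π * I * ((A + i : ℤ) : ℂ) * x) with hg
  have hre : ∑ q ∈ Finset.Icc A B, (a q : ℂ) * Complex.exp (2 * π * I * q * x) = ∑ i ∈ Finset.range L, f i • g i := by
    have e : Finset.Icc A B = (Finset.range L).image fun i : ℕ => A + i := by
      ext q
      simp only [Finset.mem_Icc, Finset.mem_image, Finset.mem_range]
      constructor
      · rintro ⟨h1, h2⟩
        refine ⟨(q - A).toNat, ?_, ?_⟩
        · have : ((q - A).toNat : ℤ) = q - A := Int.toNat_of_nonneg (by omega)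
          omega
        · have : ((q - A).toNat : ℤ) = q - A := Int.toNat_of_nonneg (by omega)
          omega
      · rintro ⟨i, hi, rfl⟩
        constructor <;> omega
    rw [e, Finset.sum_image (fun i _ j _ h => by simpa using h)]
    refine Finset.sum_congr rfl fun i _ => ?_
    simp only [hf, hg, smul_eq_mul]
  rw [hre, Finset.sum_range_by_parts]
  -- the partial geometric sums
  have hG : ∀ m : ℕ, ‖∑ j ∈ Finset.range m, g j‖ ≤ 1 / |Real.sin (π * x)| := fun m => norm_geom_sum_exp_le A m hx
  have hpos : 0 < |Real.sin (π * x)| := abs_pos.mpr hx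
  have hL1 : L - 1 = (B - A).toNat := by rw [hL]; exact Nat.add_sub_cancel _ 1
  -- monotonicity along the reindexed range
  have hmono : ∀ i, i < L - 1 → a (A + (i + 1 : ℕ)) ≤ a (A + i) := by
    intro i hi
    rw [hL1] at hi
    have := hanti (A + i) (by omega) (by omega)
    simpa [add_assoc] using this
  have hlast : f (L - 1) = (a B : ℂ) := by
    simp only [hf, hL1]; congr 1; congr 1; omega
  refine (norm_sub_le _ _).trans ?_
  have h1 : ‖f (L - 1) • ∑ j ∈ Finset.range L, g j‖ ≤ a B * (1 / |Real.sin (π * x)|) := by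
    rw [hlast, smul_eq_mul, norm_mul, Complex.norm_real, Real.norm_eq_abs, abs_of_nonneg hB0]
    exact mul_le_mul_of_nonneg_left (hG L) hB0
  have h2 : ‖∑ i ∈ Finset.range (L - 1), (f (i + 1) - f i) • ∑ j ∈ Finset.range (i + 1), g j‖ ≤
      ∑ i ∈ Finset.range (L - 1), (a (A + i) - a (A + (i + 1 : ℕ))) * (1 / |Real.sin (π * x)|) := by
    refine (norm_sum_le _ _).trans (Finset.sum_le_sum fun i hi => ?_)
    rw [Finset.mem_range] at hi
    rw [smul_eq_mul, norm_mul]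
    have hfi : ‖f (i + 1) - f i‖ = a (A + i) - a (A + (i + 1 : ℕ)) := by
      simp only [hf]
      rw [← Complex.ofReal_sub, Complex.norm_real, Real.norm_eq_abs, abs_sub_comm, abs_of_nonneg]
      exact sub_nonneg.mpr (hmono i hi)
    rw [hfi]
    exact mul_le_mul_of_nonneg_left (hG _) (by linarith [hmono i hi])
  have htel : ∑ i ∈ Finset.range (L - 1), (a (A + i) - a (A + (i + 1 : ℕ))) = a A - a B := by
    have h := Finset.sum_range_sub' (fun i : ℕ => a (A + i)) (L - 1)
    simp only [Nat.cast_zero, add_zero] at h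
    rw [h, hL1]
    congr 1; congr 1; omega
  calc ‖f (L - 1) • ∑ j ∈ Finset.range L, g j‖ +
        ‖∑ i ∈ Finset.range (L - 1), (f (i + 1) - f i) • ∑ j ∈ Finset.range (i + 1), g j‖
      ≤ a B * (1 / |Real.sin (π * x)|) +
          ∑ i ∈ Finset.range (L - 1), (a (A + i) - a (A + (i + 1 : ℕ))) * (1 / |Real.sin (π * x)|) := add_le_add h1 h2
    _ = a A / |Real.sin (π * x)| := by rw [← Finset.sum_mul, htel]; field_simp; ring


/-! ## §2 The one-tooth chirp with real strain: existence and the closed form of its coefficients -/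

/-- **The exact one-tooth chirp with REAL strain exists on the circle**: for `μ ∈ ℝ` there is a continuous `h : 𝕋 → ℂ` with
`h(t) = exp(−2πiμ·tri(2πt)/(2π))` (the `1`-periodic lift; `tri(2πt)/(2π)` is `1`-periodic and continuous). [folklore] -/
theorem exists_exactChirp_real (μ : ℝ) : ∃ h : UnitAddCircle → ℂ, Continuous h ∧
    ∀ t : ℝ, h (t : UnitAddCircle) = Complex.exp (-(2 * π * I * μ * ((tri (2 * π * t) / (2 * π) : ℝ) : ℂ))) := by
  have hper : Function.Periodic
      (fun t : ℝ => Complex.exp (-(2 * π * I * μ * ((tri (2 * π * t) / (2 * π) : ℝ) : ℂ)))) 1 := by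
    intro t
    simp only
    rw [show 2 * π * (t + 1) = 2 * π * t + 2 * π by ring, tri_periodic]
  refine ⟨hper.lift, ?_, fun t => hper.lift_coe t⟩
  have hf : Continuous fun t : ℝ => Complex.exp (-(2 * π * I * μ * ((tri (2 * π * t) / (2 * π) : ℝ) : ℂ))) := by
    refine Complex.continuous_exp.comp (Continuous.neg (continuous_const.mul (Complex.continuous_ofReal.comp ?_)))
    exact (continuous_tri.comp (continuous_const.mul continuous_id)).div_const _
  have h : hper.lift ∘ (QuotientAddGroup.mk : ℝ → UnitAddCircle) =
      fun t : ℝ => Complex.exp (-(2 * π * I * μ * ((tri (2 * π * t) / (2 * π) : ℝ) : ℂ))) := by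
    funext t; exact hper.lift_coe t
  rw [(QuotientAddGroup.isQuotientMap_mk _).continuous_iff]
  change Continuous (hper.lift ∘ (QuotientAddGroup.mk : ℝ → UnitAddCircle))
  rw [h]
  exact hf

/-- `exp(−zi) − exp(zi) = −2i·sin z`. [folklore] -/
theorem exp_neg_mul_I_sub_exp_mul_I (z : ℂ) :
    Complex.exp (-(z * I)) - Complex.exp (z * I) = -(2 * I) * Complex.sin z := by
  rw [Complex.sin, show -z * I = -(z * I) by ring]
  have hI : I * I = -1 := Complex.I_mul_I
  linear_combination (Complex.exp (-(z * I)) - Complex.exp (z * I)) * hI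


/-- **The arc integral of a character of real frequency**: for real `c ≠ 0`,
`∫_a^b exp(2πicx) dx = (exp(2πicb) − exp(2πica))/(2πic)`. [folklore] -/
theorem integral_exp_two_pi_mul (a b : ℝ) {c : ℝ} (hc : c ≠ 0) :
    ∫ x in a..b, Complex.exp (2 * π * I * c * x) =
      (Complex.exp (2 * π * I * c * b) - Complex.exp (2 * π * I * c * a)) / (2 * π * I * c) := by
  have hC : (2 * π * I * c : ℂ) ≠ 0 := by
    have hπ : (π : ℂ) ≠ 0 := Complex.ofReal_ne_zero.2 Real.pi_pos.ne'
    have hcc : (c : ℂ) ≠ 0 := Complex.ofReal_ne_zero.2 hc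
    simp [hπ, hcc, Complex.I_ne_zero]
  have h := integral_exp_mul_complex hC (a := a) (b := b)
  have e : (fun x : ℝ => Complex.exp (2 * π * I * c * x)) = fun x : ℝ => Complex.exp ((2 * π * I * c) * x) := by
    funext x; ring_nf
  rw [e, h]

/-- **CLOSED FORM of the coefficients of the exact one-tooth chirp (real strain).**  For `h(t) = exp(−2πiμ·tri(2πt)/(2π))` and
`q ∈ ℤ` with `μ + q ≠ 0`, `μ − q ≠ 0`:
`ĥ(q) = sin(π(μ+q)/2)/(π(μ+q)) + e^{−iπq}·sin(π(μ−q)/2)/(π(μ−q))` — on the rising arc `[−¼,¼]` the integrand of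
`ĥ(q) = ∫_{−¼}^{¾} e_{−q}h` is `exp(−2πi(μ+q)t)`, on the falling arc `[¼,¾]` it is `e^{−iπμ}exp(2πi(μ−q)t)`.
[cite: Grafakos2014, Prop. 3.1.2 (5)] -/
theorem fourierCoeff_exactChirp_eq {μ : ℝ} {h : UnitAddCircle → ℂ}
    (hh : ∀ t : ℝ, h (t : UnitAddCircle) = Complex.exp (-(2 * π * I * μ * ((tri (2 * π * t) / (2 * π) : ℝ) : ℂ))))
    (hhc : Continuous h) {q : ℤ} (hq₁ : μ + q ≠ 0) (hq₂ : μ - q ≠ 0) :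
    fourierCoeff h q = ((Real.sin (π * (μ + q) / 2) / (π * (μ + q)) : ℝ) : ℂ) +
      Complex.exp (-(π * I * q)) * ((Real.sin (π * (μ - q) / 2) / (π * (μ - q)) : ℝ) : ℂ) := by
  have hπ : 0 < π := Real.pi_pos
  have hπc : (π : ℂ) ≠ 0 := Complex.ofReal_ne_zero.2 hπ.ne'
  -- the coefficient as an integral over `[−¼, ¾]`
  have hF : fourierCoeff h q = ∫ x in (-(1 / 4) : ℝ)..(-(1 / 4) + 1), (fourier (-q) (x : UnitAddCircle) : ℂ) * h x := by
    rw [fourierCoeff_eq_intervalIntegral h q (-(1 / 4))]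
    simp
  set F : ℝ → ℂ := fun x => (fourier (-q) (x : UnitAddCircle) : ℂ) * h x with hFdef
  have hFc : Continuous F := ((fourier (-q)).continuous.comp continuous_quotient_mk').mul (hhc.comp continuous_quotient_mk')
  have hrise : ∀ x ∈ uIcc (-(1 / 4) : ℝ) (1 / 4), F x = Complex.exp (2 * π * I * ((-(μ + q) : ℝ)) * x) := by
    intro x hx
    rw [uIcc_of_le (by norm_num)] at hx
    have htri : tri (2 * π * x) = 2 * π * x := tri_eq_self (by nlinarith [hx.1]) (by nlinarith [hx.2])
    simp only [hFdef, hh x, htri, fourier_coe_apply]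
    rw [← Complex.exp_add]
    congr 1
    push_cast
    field_simp
    ring
  have hfall : ∀ x ∈ uIcc (1 / 4 : ℝ) (3 / 4), F x =
      Complex.exp (-(π * I * μ)) * Complex.exp (2 * π * I * ((μ - q : ℝ)) * x) := by
    intro x hx
    rw [uIcc_of_le (by norm_num)] at hx
    have htri : tri (2 * π * x) = π - 2 * π * x := tri_eq_pi_sub (by nlinarith [hx.1]) (by nlinarith [hx.2])
    simp only [hFdef, hh x, htri, fourier_coe_apply]
    rw [← Complex.exp_add, ← Complex.exp_add]
    congr 1
    push_cast
    field_simp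
    ring
  have hsplit : (∫ x in (-(1 / 4) : ℝ)..(-(1 / 4) + 1), F x) =
      (∫ x in (-(1 / 4) : ℝ)..(1 / 4), F x) + ∫ x in (1 / 4 : ℝ)..(3 / 4), F x := by
    rw [show (-(1 / 4) + 1 : ℝ) = 3 / 4 by norm_num]
    exact (integral_add_adjacent_intervals (hFc.intervalIntegrable (μ := volume) _ _)
      (hFc.intervalIntegrable (μ := volume) _ _)).symm
  -- the two arcs in closed form
  have hu : (-(μ + q) : ℝ) ≠ 0 := neg_ne_zero.mpr hq₁
  have h1 : (∫ x in (-(1 / 4) : ℝ)..(1 / 4), F x) = ((Real.sin (π * (μ + q) / 2) / (π * (μ + q)) : ℝ) : ℂ) := by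
    rw [integral_congr hrise, integral_exp_two_pi_mul _ _ hu]
    have e1 : (2 * π * I * ((-(μ + q) : ℝ) : ℂ) * ((1 / 4 : ℝ) : ℂ)) = -(((π * (μ + q) / 2 : ℝ) : ℂ) * I) := by
      push_cast; ring
    have e2 : (2 * π * I * ((-(μ + q) : ℝ) : ℂ) * ((-(1 / 4) : ℝ) : ℂ)) = ((π * (μ + q) / 2 : ℝ) : ℂ) * I := by
      push_cast; ring
    rw [e1, e2, exp_neg_mul_I_sub_exp_mul_I, ← Complex.ofReal_sin]
    have hne : ((μ + q : ℝ) : ℂ) ≠ 0 := Complex.ofReal_ne_zero.2 hq₁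
    push_cast at hne ⊢
    field_simp
  have h2 : (∫ x in (1 / 4 : ℝ)..(3 / 4), F x) =
      Complex.exp (-(π * I * q)) * ((Real.sin (π * (μ - q) / 2) / (π * (μ - q)) : ℝ) : ℂ) := by
    rw [integral_congr hfall, intervalIntegral.integral_const_mul, integral_exp_two_pi_mul _ _ hq₂]
    -- `exp(2πiv·¾) − exp(2πiv·¼) = exp(iπv)·(exp(iπv/2) − exp(−iπv/2))`
    have e1 : Complex.exp (2 * π * I * ((μ - q : ℝ) : ℂ) * ((3 / 4 : ℝ) : ℂ)) =
        Complex.exp (π * I * ((μ - q : ℝ) : ℂ)) * Complex.exp (((π * (μ - q) / 2 : ℝ) : ℂ) * I) := by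
      rw [← Complex.exp_add]; congr 1; push_cast; ring
    have e2 : Complex.exp (2 * π * I * ((μ - q : ℝ) : ℂ) * ((1 / 4 : ℝ) : ℂ)) =
        Complex.exp (π * I * ((μ - q : ℝ) : ℂ)) * Complex.exp (-(((π * (μ - q) / 2 : ℝ) : ℂ) * I)) := by
      rw [← Complex.exp_add]; congr 1; push_cast; ring
    have e3 : Complex.exp (-(π * I * μ)) * Complex.exp (π * I * ((μ - q : ℝ) : ℂ)) = Complex.exp (-(π * I * q)) := by
      rw [← Complex.exp_add]; congr 1; push_cast; ring
    rw [e1, e2]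
    have hne : ((μ - q : ℝ) : ℂ) ≠ 0 := Complex.ofReal_ne_zero.2 hq₂
    have e4 : Complex.exp (-(π * I * μ)) *
        ((Complex.exp (π * I * ((μ - q : ℝ) : ℂ)) * Complex.exp (((π * (μ - q) / 2 : ℝ) : ℂ) * I) -
          Complex.exp (π * I * ((μ - q : ℝ) : ℂ)) * Complex.exp (-(((π * (μ - q) / 2 : ℝ) : ℂ) * I))) /
          (2 * π * I * ((μ - q : ℝ) : ℂ))) =
        (Complex.exp (-(π * I * μ)) * Complex.exp (π * I * ((μ - q : ℝ) : ℂ))) *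
          (Complex.exp (((π * (μ - q) / 2 : ℝ) : ℂ) * I) - Complex.exp (-(((π * (μ - q) / 2 : ℝ) : ℂ) * I))) /
          (2 * π * I * ((μ - q : ℝ) : ℂ)) := by ring
    have hx : Complex.exp (((π * (μ - q) / 2 : ℝ) : ℂ) * I) - Complex.exp (-(((π * (μ - q) / 2 : ℝ) : ℂ) * I)) =
        2 * I * Complex.sin ((π * (μ - q) / 2 : ℝ) : ℂ) := by
      have h0 := exp_neg_mul_I_sub_exp_mul_I (((π * (μ - q) / 2 : ℝ) : ℂ))
      linear_combination -h0
    rw [e4, e3, hx, ← Complex.ofReal_sin]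
    push_cast at hne ⊢
    field_simp
  rw [hF, hsplit, h1, h2]


end Summit.AnomalousDissipation.AnomalousDissipation.Theorems.SawtoothPulseCascade.K1Window
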